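import Summits.QuantumFields.YangMills.Theorems.UnitScaleTiltProp7TorusGreen2HeatKernel
import Summits.QuantumFields.YangMills.Theorems.UnitScaleTiltProp7TorusHeatKernelThirdDiffThree
import Summits.QuantumFields.YangMills.Theorems.UnitScaleTiltProp7TorusGreenHessianDecay
import HarnessLib

/-!
# Route `UnitScaleTilt`, crux K1 «MinimiserStabilityRegPr» (stmt-QuantumFields-19200), route-R E′ path (α′), residue (hK), far-field fork (A3), row (R3): DECAY OF THE HESSIAN OF THE
# ZERO-MODE-REMOVED BIHARMONIC TORUS GREEN FUNCTION `G̃₂(z) = L^{-d} Σ_{k≠0} cos(p_k·z)∕ε(p_k)²` IN `d = 3`, UNIFORM IN THE PERIOD — `|∇ᵢ⁺∇ⱼ⁻G̃₂(z)|·dist(0,z) ≤ C` for `z ≠ 0`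
# (`dist(0,z)² = Σ_μ z̃_μ²`, `z̃ = valMinAbs`): the lattice, finite-volume form of `∂ᵢ∂ⱼ|x| = O(|x|⁻¹)` for the biharmonic fundamental solution `−|x|∕(8π)` of `ℝ³`, i.e. the `G₂`
# second-difference row that (A3)'s biharmonic-level peeling `χ·∇_bG̃₂` consumes (★routeR-w3 g5 NAMING 19:28:35Z, SWAP 19:29:26Z «(R3) = w8»; sibling rows (R1) routeR-w2, (R2) px13)

Cell `ym3-torus`, D-0154 (3c) twin-width seat `ym-ust-19200-w8` (gen 7).  The `ε⁻²` sibling of ✓p661087 `…Prop7TorusGreenHessianDecay.torusGreen_hessian_mul_dist_cube_le` (`ε⁻¹`: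
`|∇∇G̃₁|·dist³ ≤ C`) by the same heat-kernel route with ONE extra factor `s` in the time integral, over px13's (R2) part A ✓ `…Prop7TorusGreen2HeatKernel` (the `G̃₂` representation of
record: `1∕ε² = ∫₀^S s·e^{−sε} ds + e^{−Sε}(1+Sε)∕ε²`, `torusGreen2_eq_integral_add_tail`, and the halved-exponent tail letters): the product-kernel Hessian bound
✓ `abs_hessian_prod_torusHeatKernel_le_three` (`K·√(1∨s)·(((1∨s)+M²)³)⁻¹`) times `s` has time integral `≤ 2∕M` (px9's (R3-aux) letter); the Fourier tail of the Hessian is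
`O(L^{2−d}) = O(M⁻¹)`; `dist ≤ 2M`.  THEOREMS ONLY (0 `def`, 0 `sorry`): `G̃₂` enters through the DISPLAYED DEFINITION HYPOTHESIS `hG : ∀ z, G z = (Σ_{k≠0} cos(p_k·z)∕ε(p_k)²)∕L^d`
(★routeR-w3 g5 CURRENCY RULING 19:39:22Z; = lit ✓ `LatticeGreenFunction.torusGreen`'s text with `ε ↦ ε²` = the LHS of px13's `torusGreen2_eq_integral_add_tail`), which a consumer instantiates
by `rfl`; `--supports stmt-QuantumFields-19200`, count-neutral.  YM₃ on T³ is a ladder rung (R3), not the Clay problem; nothing here claims the stub, the crux, d = 4 or the gap.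

WHAT IS PROVED (ns `…Theorems.Prop7TorusGreen2HessianDecay`; carrier `TorusSite d L = Fin d → ZMod L`, `torusHeatKernel` of ✓ `TorusHeatKernel1D`).
* §1 ★ `hessian_eq` (any `d`) — `∇ᵢ⁺∇ⱼ⁻G(z) = ∫₀^S s·∇ᵢ⁺∇ⱼ⁻[∏_μ q^L_s](z) ds + L^{−d}Σ_{k≠0} (e^{−Sε_k}(1+Sε_k)∕ε_k²)·Re[χ_k(z)(χ_k(eᵢ)−1)(1−conj χ_k(eⱼ))]`.
* §2 (any `d`) `eight_div_sq_le_dispersion` (`k ≠ 0 ⇒ 8∕L² ≤ ε(p_k)`, the spectral gap), ★ `abs_hessian_tail_le` — at `S = L²` the tail is `≤ (π²∕8)·C₀^d·L²∕L^d`, `C₀ = Σ_{n∈ℤ}2^{−|n|}`.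
* §3 ★★★ `hessian_mul_dist_le` (`d = 3`) — `∃ C, ∀ L ≥ 1, ∀ G with hG, ∀ i j, ∀ z ≠ 0: |G(z+eᵢ) − G(z+eᵢ−eⱼ) − G(z) + G(z−eⱼ)|·√(Σ_μ z̃_μ²) ≤ C` (`C = 4K + (π²∕8)C₀³`); the `s`-weighted time
  integral `∫₀^{L²} s·√(1∨s)·(((1∨s)+M²)³)⁻¹ ds ≤ 2∕M` is px9's (R3-aux) ✓ `…Prop7TorusHeatKernelThirdDiffThree.integral_mul_sqrt_mul_inv_cube_le` (the `3∕2`-power route — NOT AM–GM, which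
  with the weight `s` would give `∫(s+M²)⁻¹ = log L`).
HONEST SCOPE.  A Literature-grade lattice lemma placed in the Summits lineage that needs it; no Yang–Mills statement is touched.  The third-difference sibling `|∇³G̃₂|·Σz̃² ≤ C` is the
next file of this row (over px9's ✓ `abs_thirdDiff_hessian_prod_torusHeatKernel_le_three` + `integral_mul_inv_cube_le`).

References: G. F. Lawler, V. Limic, *Random Walk: A Modern Introduction*, CUP 2010, Thm 4.3.1, §6.3 [LawlerLimic2010]; G. F. Lawler, *Intersections of Random Walks* (1991)
Thm 1.5.5; T. Bałaban, CMP 99 (1985) 75–102 [Balaban1985RegularSpaces] ((1.36) p.82).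
-/

set_option autoImplicit false

noncomputable section

open MeasureTheory Set Finset ZMod intervalIntegral
open scoped Real BigOperators ComplexConjugate

namespace Summit.QuantumFields.YangMills.Theorems.Prop7TorusGreen2HessianDecay

open Literature.Probability.LatticeModels
open Prop7TorusGreenHessianDecay Prop7TorusGreen2HeatKernel Prop7TorusHeatKernelThirdDiffThree

variable {d L : ℕ} [NeZero L]

/-! ## §1 The Hessian of `G̃₂`: heat-kernel part plus Fourier tail -/

/-- ★ **The Hessian of `G̃₂`, heat-kernel part plus Fourier tail**: if `G z = L^{−d}Σ_{k≠0} cos(p_k·z)∕ε(p_k)²` then for every `S`,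
`∇ᵢ⁺∇ⱼ⁻G(z) = ∫₀^S s·∇ᵢ⁺∇ⱼ⁻[∏_μ q^L_s(·_μ)](z) ds + L^{−d} Σ_{k≠0} (e^{−Sε_k}(1+Sε_k)∕ε_k²)·Re[χ_k(z)(χ_k(eᵢ) − 1)(1 − conj χ_k(eⱼ))]`,
`∇ᵢ⁺∇ⱼ⁻F(z) = F(z+eᵢ) − F(z+eᵢ−eⱼ) − F(z) + F(z−eⱼ)` (the constant `L^{−d}` drops out of the difference; `cos(p_k·y) = Re χ_k(y)`, `χ_k(z ± e) = χ_k(z)χ_k(e)^{±1}`). [folklore] -/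
theorem hessian_eq (G : TorusSite d L → ℝ)
    (hG : ∀ z, G z = (∑ k ∈ (univ : Finset (TorusSite d L)).erase 0,
      Real.cos (∑ i, latticeMomentum L k i * ((z i).val : ℝ)) / dispersion (latticeMomentum L k) ^ 2) / (L : ℝ) ^ d)
    (z : TorusSite d L) (i j : Fin d) (S : ℝ) :
    G (z + Pi.single i 1) - G (z + Pi.single i 1 - Pi.single j 1) - G z + G (z - Pi.single j 1) =
      (∫ s in (0 : ℝ)..S, s *
        ((∏ μ, torusHeatKernel s ((z + Pi.single i 1 : TorusSite d L) μ)) -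
          (∏ μ, torusHeatKernel s ((z + Pi.single i 1 - Pi.single j 1 : TorusSite d L) μ)) -
          (∏ μ, torusHeatKernel s (z μ)) + ∏ μ, torusHeatKernel s ((z - Pi.single j 1 : TorusSite d L) μ))) +
      (∑ k ∈ (univ : Finset (TorusSite d L)).erase 0,
        Real.exp (-(S * dispersion (latticeMomentum L k))) * (1 + S * dispersion (latticeMomentum L k)) /
            dispersion (latticeMomentum L k) ^ 2 *
          (torusChar k z * (torusChar k (Pi.single i 1) - 1) *
            (1 - conj (torusChar k (Pi.single j 1)))).re) / (L : ℝ) ^ d := by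
  have hI : ∀ y : TorusSite d L, IntervalIntegrable
      (fun s : ℝ => s * (∏ μ, torusHeatKernel s (y μ) - ((L : ℝ) ^ d)⁻¹)) volume 0 S := fun y =>
    (continuous_id.mul ((continuous_prod_torusHeatKernel y).sub continuous_const)).intervalIntegrable _ _
  rw [hG, hG, hG, hG, torusGreen2_eq_integral_add_tail (z + Pi.single i 1) S,
    torusGreen2_eq_integral_add_tail (z + Pi.single i 1 - Pi.single j 1) S,
    torusGreen2_eq_integral_add_tail z S, torusGreen2_eq_integral_add_tail (z - Pi.single j 1) S]
  have hint : (∫ s in (0 : ℝ)..S, s *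
        ((∏ μ, torusHeatKernel s ((z + Pi.single i 1 : TorusSite d L) μ)) -
          (∏ μ, torusHeatKernel s ((z + Pi.single i 1 - Pi.single j 1 : TorusSite d L) μ)) -
          (∏ μ, torusHeatKernel s (z μ)) + ∏ μ, torusHeatKernel s ((z - Pi.single j 1 : TorusSite d L) μ))) =
      (∫ s in (0 : ℝ)..S, s * (∏ μ, torusHeatKernel s ((z + Pi.single i 1 : TorusSite d L) μ) - ((L : ℝ) ^ d)⁻¹)) -
      (∫ s in (0 : ℝ)..S, s * (∏ μ, torusHeatKernel s ((z + Pi.single i 1 - Pi.single j 1 : TorusSite d L) μ) -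
        ((L : ℝ) ^ d)⁻¹)) -
      (∫ s in (0 : ℝ)..S, s * (∏ μ, torusHeatKernel s (z μ) - ((L : ℝ) ^ d)⁻¹)) +
      (∫ s in (0 : ℝ)..S, s * (∏ μ, torusHeatKernel s ((z - Pi.single j 1 : TorusSite d L) μ) - ((L : ℝ) ^ d)⁻¹)) := by
    rw [← intervalIntegral.integral_sub (hI _) (hI _), ← intervalIntegral.integral_sub
      ((hI _).sub (hI _)) (hI _), ← intervalIntegral.integral_add (((hI _).sub (hI _)).sub (hI _))
      (hI _)]
    congr 1
    funext s
    ring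
  rw [hint]
  -- the tails
  have htail : ∀ k : TorusSite d L,
      Real.cos (∑ μ, latticeMomentum L k μ * (((z + Pi.single i 1 : TorusSite d L) μ).val : ℝ)) *
          (Real.exp (-(S * dispersion (latticeMomentum L k))) * (1 + S * dispersion (latticeMomentum L k)) /
            dispersion (latticeMomentum L k) ^ 2) -
        Real.cos (∑ μ, latticeMomentum L k μ * (((z + Pi.single i 1 - Pi.single j 1 : TorusSite d L) μ).val : ℝ)) *
          (Real.exp (-(S * dispersion (latticeMomentum L k))) * (1 + S * dispersion (latticeMomentum L k)) /
            dispersion (latticeMomentum L k) ^ 2) -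
        Real.cos (∑ μ, latticeMomentum L k μ * ((z μ).val : ℝ)) *
          (Real.exp (-(S * dispersion (latticeMomentum L k))) * (1 + S * dispersion (latticeMomentum L k)) /
            dispersion (latticeMomentum L k) ^ 2) +
        Real.cos (∑ μ, latticeMomentum L k μ * (((z - Pi.single j 1 : TorusSite d L) μ).val : ℝ)) *
          (Real.exp (-(S * dispersion (latticeMomentum L k))) * (1 + S * dispersion (latticeMomentum L k)) /
            dispersion (latticeMomentum L k) ^ 2) =
      Real.exp (-(S * dispersion (latticeMomentum L k))) * (1 + S * dispersion (latticeMomentum L k)) /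
          dispersion (latticeMomentum L k) ^ 2 *
        (torusChar k z * (torusChar k (Pi.single i 1) - 1) *
          (1 - conj (torusChar k (Pi.single j 1)))).re := by
    intro k
    rw [← torusChar_re, ← torusChar_re, ← torusChar_re, ← torusChar_re, torusChar_sub_right,
      torusChar_add_right, torusChar_sub_right]
    simp only [Complex.sub_re, Complex.mul_re, Complex.one_re, Complex.one_im,
      Complex.conj_re, Complex.conj_im, Complex.sub_im, Complex.mul_im]
    ring
  rw [← Finset.sum_congr rfl fun k _ => htail k, Finset.sum_add_distrib, Finset.sum_sub_distrib,
    Finset.sum_sub_distrib]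
  ring

/-! ## §2 The Fourier tail of the Hessian at `S = L²` -/

/-- **Spectral gap of the discrete torus**: for `k ≠ 0`, `8∕L² ≤ ε(p_k)` (`ε ≥ (2∕π²)‖p̃_k‖²_∞` on the Brillouin zone and `‖p̃_k‖_∞ ≥ 2π∕L`). [folklore] -/
theorem eight_div_sq_le_dispersion (k : TorusSite d L) (hk : k ≠ 0) :
    8 / (L : ℝ) ^ 2 ≤ dispersion (latticeMomentum L k) := by
  have hL : (0 : ℝ) < L := by exact_mod_cast Nat.pos_of_ne_zero (NeZero.ne L)
  set p : Fin d → ℝ := fun μ => 2 * π * ((k μ).valMinAbs : ℝ) / L with hp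
  have hε := mul_norm_sq_le_dispersion (centredMomentum_mem_brillouin k)
  rw [← dispersion_latticeMomentum_eq_centred] at hε
  obtain ⟨μ₁, hμ₁⟩ : ∃ μ, k μ ≠ 0 := by
    by_contra h
    push Not at h
    exact hk (funext h)
  have h1 : (1 : ℝ) ≤ |((k μ₁).valMinAbs : ℝ)| := by
    have h0 : (k μ₁).valMinAbs ≠ 0 := fun h => hμ₁ ((ZMod.valMinAbs_eq_zero _).1 h)
    rw [← Int.cast_abs]; exact_mod_cast Int.one_le_abs h0
  have hpμ : 2 * π / L ≤ ‖p‖ := by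
    have hle : |p μ₁| ≤ ‖p‖ := le_of_eq_of_le (Real.norm_eq_abs _).symm (norm_le_pi_norm p μ₁)
    have e : |p μ₁| = 2 * π * |((k μ₁).valMinAbs : ℝ)| / L := by
      rw [hp]; simp only
      rw [abs_div, abs_mul, abs_mul, abs_two, abs_of_pos Real.pi_pos, Nat.abs_cast]
    rw [e] at hle
    have : 2 * π / L ≤ 2 * π * |((k μ₁).valMinAbs : ℝ)| / L := by
      rw [div_le_div_iff_of_pos_right hL]; nlinarith [Real.pi_pos]
    exact this.trans hle
  have hsq : (2 * π / L) ^ 2 ≤ ‖p‖ ^ 2 := pow_le_pow_left₀ (by positivity) hpμ 2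
  calc 8 / (L : ℝ) ^ 2 = 2 / π ^ 2 * (2 * π / L) ^ 2 := by field_simp; ring
    _ ≤ 2 / π ^ 2 * ‖p‖ ^ 2 := by gcongr
    _ ≤ dispersion (latticeMomentum L k) := hε

/-- ★ **The Fourier tail of the Hessian of `G̃₂` is `O(L^{2−d})`**: with `C₀ = Σ_{n∈ℤ}2^{−|n|}`, for all `z, i, j`,
`|L^{−d}Σ_{k≠0} (e^{−L²ε_k}(1+L²ε_k)∕ε_k²)·Re[χ_k(z)(χ_k(eᵢ)−1)(1−conj χ_k(eⱼ))]| ≤ (π²∕8)·C₀^d·L²∕L^d`: the multiplier bound `(π²∕2)ε_k` (✓ `norm_torusChar_single_sub_one_mul_le`) cancels one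
`ε_k`, the spectral gap `1∕ε_k ≤ L²∕8` the other, `(1+x)e^{−x} ≤ 2e^{−x∕2}` (✓ px13 `add_one_mul_exp_neg_le`), and `Σ_k e^{−L²ε_k∕2} ≤ (Σ_κ 2^{−|κ̃|})^d ≤ C₀^d` (✓ px13
`exp_neg_half_sq_mul_dispersion_le` ∕ `exp_neg_four_mul_sq_le`). [folklore] -/
theorem abs_hessian_tail_le (z : TorusSite d L) (i j : Fin d) :
    |(∑ k ∈ (univ : Finset (TorusSite d L)).erase 0,
        Real.exp (-((L : ℝ) ^ 2 * dispersion (latticeMomentum L k))) * (1 + (L : ℝ) ^ 2 * dispersion (latticeMomentum L k)) /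
            dispersion (latticeMomentum L k) ^ 2 *
          (torusChar k z * (torusChar k (Pi.single i 1) - 1) *
            (1 - conj (torusChar k (Pi.single j 1)))).re) / (L : ℝ) ^ d| ≤
      π ^ 2 / 8 * (∑' n : ℤ, (1 / 2 : ℝ) ^ n.natAbs) ^ d * (L : ℝ) ^ 2 / (L : ℝ) ^ d := by
  classical
  have hL : (0 : ℝ) < L := by exact_mod_cast Nat.pos_of_ne_zero (NeZero.ne L)
  have hLd : (0 : ℝ) < (L : ℝ) ^ d := by positivity
  rw [abs_div, abs_of_pos hLd, div_le_div_iff_of_pos_right hLd]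
  -- termwise bound
  have hterm : ∀ k ∈ (univ : Finset (TorusSite d L)).erase 0,
      |Real.exp (-((L : ℝ) ^ 2 * dispersion (latticeMomentum L k))) * (1 + (L : ℝ) ^ 2 * dispersion (latticeMomentum L k)) /
            dispersion (latticeMomentum L k) ^ 2 *
          (torusChar k z * (torusChar k (Pi.single i 1) - 1) *
            (1 - conj (torusChar k (Pi.single j 1)))).re| ≤
        π ^ 2 / 8 * (L : ℝ) ^ 2 * ∏ μ, (1 / 2 : ℝ) ^ (k μ).valMinAbs.natAbs := by
    intro k hk
    have hk0 : k ≠ 0 := Finset.ne_of_mem_erase hk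
    have hε := dispersion_latticeMomentum_pos hk0
    set ε : ℝ := dispersion (latticeMomentum L k) with hεdef
    have hx : 0 ≤ (L : ℝ) ^ 2 * ε := by positivity
    have hgap : ε⁻¹ ≤ (L : ℝ) ^ 2 / 8 := by
      have h8 := eight_div_sq_le_dispersion k hk0
      rw [← hεdef] at h8
      calc ε⁻¹ ≤ (8 / (L : ℝ) ^ 2)⁻¹ := inv_anti₀ (by positivity) h8
        _ = (L : ℝ) ^ 2 / 8 := by rw [inv_div]
    have hre : |(torusChar k z * (torusChar k (Pi.single i 1) - 1) *
        (1 - conj (torusChar k (Pi.single j 1)))).re| ≤ π ^ 2 / 2 * ε := by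
      refine (Complex.abs_re_le_norm _).trans ?_
      rw [norm_mul, norm_mul, norm_torusChar, one_mul, ← norm_neg (1 - conj (torusChar k (Pi.single j 1))),
        neg_sub, ← Complex.norm_conj (conj (torusChar k (Pi.single j 1)) - 1), map_sub, map_one,
        Complex.conj_conj]
      exact norm_torusChar_single_sub_one_mul_le k i j
    have hexp : Real.exp (-((L : ℝ) ^ 2 * ε / 2)) ≤ ∏ μ, (1 / 2 : ℝ) ^ (k μ).valMinAbs.natAbs :=
      (exp_neg_half_sq_mul_dispersion_le k).trans (Finset.prod_le_prod (fun μ _ => (Real.exp_pos _).le)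
        fun μ _ => exp_neg_four_mul_sq_le _)
    have hdec : (1 + (L : ℝ) ^ 2 * ε) * Real.exp (-((L : ℝ) ^ 2 * ε)) ≤ 2 * Real.exp (-((L : ℝ) ^ 2 * ε / 2)) :=
      add_one_mul_exp_neg_le hx
    rw [abs_mul, abs_div, abs_mul, Real.abs_exp, abs_of_nonneg (by positivity : (0 : ℝ) ≤ 1 + (L : ℝ) ^ 2 * ε),
      abs_of_pos (by positivity : (0 : ℝ) < ε ^ 2)]
    calc Real.exp (-((L : ℝ) ^ 2 * ε)) * (1 + (L : ℝ) ^ 2 * ε) / ε ^ 2 *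
          |(torusChar k z * (torusChar k (Pi.single i 1) - 1) * (1 - conj (torusChar k (Pi.single j 1)))).re|
        ≤ Real.exp (-((L : ℝ) ^ 2 * ε)) * (1 + (L : ℝ) ^ 2 * ε) / ε ^ 2 * (π ^ 2 / 2 * ε) := by gcongr
      _ = π ^ 2 / 2 * ((1 + (L : ℝ) ^ 2 * ε) * Real.exp (-((L : ℝ) ^ 2 * ε))) * ε⁻¹ := by
          field_simp
      _ ≤ π ^ 2 / 2 * (2 * Real.exp (-((L : ℝ) ^ 2 * ε / 2))) * ((L : ℝ) ^ 2 / 8) := by gcongr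
      _ = π ^ 2 / 8 * (L : ℝ) ^ 2 * Real.exp (-((L : ℝ) ^ 2 * ε / 2)) := by ring
      _ ≤ π ^ 2 / 8 * (L : ℝ) ^ 2 * ∏ μ, (1 / 2 : ℝ) ^ (k μ).valMinAbs.natAbs := by gcongr
  calc |∑ k ∈ (univ : Finset (TorusSite d L)).erase 0,
        Real.exp (-((L : ℝ) ^ 2 * dispersion (latticeMomentum L k))) * (1 + (L : ℝ) ^ 2 * dispersion (latticeMomentum L k)) /
            dispersion (latticeMomentum L k) ^ 2 *
          (torusChar k z * (torusChar k (Pi.single i 1) - 1) *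
            (1 - conj (torusChar k (Pi.single j 1)))).re|
      ≤ ∑ k ∈ (univ : Finset (TorusSite d L)).erase 0,
          π ^ 2 / 8 * (L : ℝ) ^ 2 * ∏ μ, (1 / 2 : ℝ) ^ (k μ).valMinAbs.natAbs :=
        (Finset.abs_sum_le_sum_abs _ _).trans (Finset.sum_le_sum hterm)
    _ ≤ ∑ k : TorusSite d L, π ^ 2 / 8 * (L : ℝ) ^ 2 * ∏ μ, (1 / 2 : ℝ) ^ (k μ).valMinAbs.natAbs :=
        Finset.sum_le_sum_of_subset_of_nonneg (Finset.erase_subset _ _) fun _ _ _ => by positivity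
    _ = π ^ 2 / 8 * (L : ℝ) ^ 2 * (∑ κ : ZMod L, (1 / 2 : ℝ) ^ κ.valMinAbs.natAbs) ^ d := by
        rw [← Finset.mul_sum]
        congr 1
        rw [show (∑ κ : ZMod L, (1 / 2 : ℝ) ^ κ.valMinAbs.natAbs) ^ d =
            ∏ _μ : Fin d, ∑ κ : ZMod L, (1 / 2 : ℝ) ^ κ.valMinAbs.natAbs by
          rw [Finset.prod_const, Finset.card_univ, Fintype.card_fin],
          Finset.prod_univ_sum]
        simp only [Fintype.piFinset_univ]
    _ ≤ π ^ 2 / 8 * (L : ℝ) ^ 2 * (∑' n : ℤ, (1 / 2 : ℝ) ^ n.natAbs) ^ d := by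
        gcongr
        exact sum_half_pow_valMinAbs_le
    _ = π ^ 2 / 8 * (∑' n : ℤ, (1 / 2 : ℝ) ^ n.natAbs) ^ d * (L : ℝ) ^ 2 := by ring


/-! ## §3 ★★★ The Hessian decay of `G̃₂` in `d = 3` -/

/-- ★★★ **DECAY OF THE HESSIAN OF THE ZERO-MODE-FREE `Δ⁻²` KERNEL OF `(ℤ/Lℤ)³`, UNIFORMLY IN THE PERIOD.**  There is an absolute constant `C` such that for every `L ≥ 1`, every
`G : (ℤ/Lℤ)³ → ℝ` with `G z = L⁻³ Σ_{k≠0} cos(p_k·z)∕ε(p_k)²` (`= G̃₂`, the `ε⁻²` sibling of ✓ `torusGreen`), all directions `i, j` and every `z ≠ 0`: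
`|G(z+eᵢ) − G(z+eᵢ−eⱼ) − G(z) + G(z−eⱼ)| · √(Σ_μ z̃_μ²) ≤ C`
(`z̃_μ = valMinAbs (z μ)`): the lattice, finite-volume form of `|∂ᵢ∂ⱼ|x|| ≲ |x|⁻¹` for the biharmonic fundamental solution `−|x|∕(8π)` of `ℝ³`, with a constant independent of
`L`.  Heat-kernel part `≤ K·∫₀^{L²} s·√(1∨s)·(((1∨s)+M²)³)⁻¹ds ≤ 2K∕M` (✓ `abs_hessian_prod_torusHeatKernel_le_three` × `s`, px9's ✓ `integral_mul_sqrt_mul_inv_cube_le`;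
`M = max_μ|z̃_μ| ≥ 1`), Fourier tail `≤ (π²∕8)C₀³L⁻¹ ≤ (π²∕16)C₀³M⁻¹` (✓ `abs_hessian_tail_le`, `2M ≤ L`), and `√(Σz̃²) ≤ 2M`; `C = 4K + (π²∕8)C₀³`. [folklore] -/
theorem hessian_mul_dist_le : ∃ C : ℝ, ∀ (L : ℕ) [NeZero L] (G : TorusSite 3 L → ℝ),
    (∀ z, G z = (∑ k ∈ (univ : Finset (TorusSite 3 L)).erase 0,
      Real.cos (∑ i, latticeMomentum L k i * ((z i).val : ℝ)) / dispersion (latticeMomentum L k) ^ 2) / (L : ℝ) ^ 3) →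
    ∀ (i j : Fin 3) (z : TorusSite 3 L), z ≠ 0 →
      |G (z + Pi.single i 1) - G (z + Pi.single i 1 - Pi.single j 1) - G z + G (z - Pi.single j 1)| *
        Real.sqrt (∑ k, (((z k).valMinAbs : ℤ) : ℝ) ^ 2) ≤ C := by
  obtain ⟨K, hK, hP⟩ := abs_hessian_prod_torusHeatKernel_le_three
  set C₀ : ℝ := ∑' n : ℤ, (1 / 2 : ℝ) ^ n.natAbs with hC₀
  refine ⟨4 * K + π ^ 2 / 8 * C₀ ^ 3, ?_⟩
  intro L _ G hG i j z hz
  have hL : (0 : ℝ) < L := by exact_mod_cast Nat.pos_of_ne_zero (NeZero.ne L)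
  -- the largest centred coordinate
  obtain ⟨μ₀, -, hμ₀⟩ := Finset.exists_max_image (univ : Finset (Fin 3))
    (fun μ => (z μ).valMinAbs.natAbs) Finset.univ_nonempty
  set M : ℝ := |((z μ₀).valMinAbs : ℝ)| with hM
  have hMμ : ∀ μ, |((z μ).valMinAbs : ℝ)| ≤ M := fun μ => by
    have h := hμ₀ μ (Finset.mem_univ μ)
    rw [hM, ← Int.cast_abs, ← Int.cast_abs, ← Int.natCast_natAbs, ← Int.natCast_natAbs]
    exact_mod_cast h
  have hM1 : 1 ≤ M := by
    obtain ⟨μ₁, hμ₁⟩ : ∃ μ, z μ ≠ 0 := by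
      by_contra h
      push Not at h
      exact hz (funext h)
    have h1 : (z μ₁).valMinAbs ≠ 0 := fun h => hμ₁ ((ZMod.valMinAbs_eq_zero _).1 h)
    have h2 : (1 : ℝ) ≤ |((z μ₁).valMinAbs : ℝ)| := by
      rw [← Int.cast_abs]
      exact_mod_cast Int.one_le_abs h1
    exact h2.trans (hMμ μ₁)
  have hM0 : 0 < M := by linarith
  have hML : 2 * M ≤ L := by
    have h := two_mul_abs_valMinAbs_le (z μ₀)
    rw [hM, ← Int.cast_abs]
    exact_mod_cast h
  -- the distance: `√(Σz̃²) ≤ 2M`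
  have hdist0 : 0 ≤ ∑ k, (((z k).valMinAbs : ℤ) : ℝ) ^ 2 := Finset.sum_nonneg fun k _ => sq_nonneg _
  have hdist : Real.sqrt (∑ k, (((z k).valMinAbs : ℤ) : ℝ) ^ 2) ≤ 2 * M := by
    have hsum : ∑ k, (((z k).valMinAbs : ℤ) : ℝ) ^ 2 ≤ (2 * M) ^ 2 := by
      calc ∑ k, (((z k).valMinAbs : ℤ) : ℝ) ^ 2 ≤ ∑ _k : Fin 3, M ^ 2 :=
            Finset.sum_le_sum fun k _ => by
              rw [← sq_abs]
              exact pow_le_pow_left₀ (abs_nonneg _) (hMμ k) 2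
        _ = 3 * M ^ 2 := by simp
        _ ≤ (2 * M) ^ 2 := by nlinarith
    rw [← Real.sqrt_sq (by positivity : (0 : ℝ) ≤ 2 * M)]
    exact Real.sqrt_le_sqrt hsum
  -- the Hessian: heat-kernel part and tail at `S = L²`
  have hS : (0 : ℝ) ≤ (L : ℝ) ^ 2 := by positivity
  rw [hessian_eq G hG z i j ((L : ℝ) ^ 2)]
  have hmain : |∫ s in (0 : ℝ)..(L : ℝ) ^ 2, s *
      ((∏ μ, torusHeatKernel s ((z + Pi.single i 1 : TorusSite 3 L) μ)) -
        (∏ μ, torusHeatKernel s ((z + Pi.single i 1 - Pi.single j 1 : TorusSite 3 L) μ)) -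
        (∏ μ, torusHeatKernel s (z μ)) +
        ∏ μ, torusHeatKernel s ((z - Pi.single j 1 : TorusSite 3 L) μ))| ≤ K * (2 / M) := by
    have hcM : ((z μ₀).valMinAbs : ℝ) ^ 2 = M ^ 2 := by rw [hM, sq_abs]
    have hb : ∀ s ∈ Set.Ioc (0 : ℝ) ((L : ℝ) ^ 2),
        |s * ((∏ μ, torusHeatKernel s ((z + Pi.single i 1 : TorusSite 3 L) μ)) -
          (∏ μ, torusHeatKernel s ((z + Pi.single i 1 - Pi.single j 1 : TorusSite 3 L) μ)) -
          (∏ μ, torusHeatKernel s (z μ)) +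
          ∏ μ, torusHeatKernel s ((z - Pi.single j 1 : TorusSite 3 L) μ))| ≤
        K * (s * Real.sqrt (max 1 s) * ((max 1 s + M ^ 2) ^ 3)⁻¹) := by
      intro s hs
      rw [abs_mul, abs_of_pos hs.1]
      have h := hP L s hs.1 hs.2 z i j μ₀
      rw [hcM] at h
      calc s * |(∏ μ, torusHeatKernel s ((z + Pi.single i 1 : TorusSite 3 L) μ)) -
            (∏ μ, torusHeatKernel s ((z + Pi.single i 1 - Pi.single j 1 : TorusSite 3 L) μ)) -
            (∏ μ, torusHeatKernel s (z μ)) +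
            ∏ μ, torusHeatKernel s ((z - Pi.single j 1 : TorusSite 3 L) μ)|
          ≤ s * (K * Real.sqrt (max 1 s) * ((max 1 s + M ^ 2) ^ 3)⁻¹) := mul_le_mul_of_nonneg_left h hs.1.le
        _ = K * (s * Real.sqrt (max 1 s) * ((max 1 s + M ^ 2) ^ 3)⁻¹) := by ring
    have hcont : IntervalIntegrable (fun s : ℝ => K * (s * Real.sqrt (max 1 s) * ((max 1 s + M ^ 2) ^ 3)⁻¹))
        volume 0 ((L : ℝ) ^ 2) := by
      refine Continuous.intervalIntegrable ?_ _ _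
      refine continuous_const.mul ((continuous_id.mul (continuous_const.max continuous_id).sqrt).mul
        ((((continuous_const.max continuous_id).add continuous_const).pow 3).inv₀ fun s => ?_))
      exact pow_ne_zero 3 (add_pos_of_pos_of_nonneg (lt_of_lt_of_le one_pos (le_max_left 1 s)) (sq_nonneg M)).ne'
    calc _ ≤ ∫ s in (0 : ℝ)..(L : ℝ) ^ 2, K * (s * Real.sqrt (max 1 s) * ((max 1 s + M ^ 2) ^ 3)⁻¹) := by
          have h := intervalIntegral.norm_integral_le_of_norm_le hS
            (Filter.Eventually.of_forall fun s hs => (Real.norm_eq_abs _).le.trans (hb s hs)) hcont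
          rwa [Real.norm_eq_abs] at h
      _ = K * ∫ s in (0 : ℝ)..(L : ℝ) ^ 2, s * Real.sqrt (max 1 s) * ((max 1 s + M ^ 2) ^ 3)⁻¹ :=
          intervalIntegral.integral_const_mul _ _
      _ ≤ K * (2 / M) := by
          gcongr
          exact integral_mul_sqrt_mul_inv_cube_le hM0 hS
  have htail := abs_hessian_tail_le z i j (L := L) (d := 3)
  rw [← hC₀] at htail
  -- `L²/L³ = 1/L ≤ 1/(2M)`
  have hL3 : (L : ℝ) ^ 2 / (L : ℝ) ^ 3 ≤ (2 * M)⁻¹ := by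
    rw [show (L : ℝ) ^ 2 / (L : ℝ) ^ 3 = ((L : ℝ))⁻¹ by field_simp]
    exact inv_anti₀ (by positivity) hML
  calc _ ≤ (K * (2 / M) + π ^ 2 / 8 * C₀ ^ 3 * (L : ℝ) ^ 2 / (L : ℝ) ^ 3) * (2 * M) :=
        mul_le_mul ((abs_add_le _ _).trans (add_le_add hmain htail)) hdist (Real.sqrt_nonneg _)
          (by positivity)
    _ ≤ (K * (2 / M) + π ^ 2 / 8 * C₀ ^ 3 * (2 * M)⁻¹) * (2 * M) := by
        gcongr
        rw [mul_div_assoc]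
        gcongr
    _ = 4 * K + π ^ 2 / 8 * C₀ ^ 3 := by
        field_simp
        ring

end Summit.QuantumFields.YangMills.Theorems.Prop7TorusGreen2HessianDecay
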